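import Summits.QuantumFields.GaugeBoot.FullSpaceGroupBootstrapConvergenceZd
import HarnessLib

/-!
# Kazakov–Zheng's three reflection families of `ℤ^d` as symmetries: all inside `B_d ⋉ ℤ^d` (gauge-boot, L1/L4 supplement)

HONEST FRAMING (cell `pub-gaugeboot`, page 1 of every file): the venture produces certified bounds
on lattice expectations at stated coupling, gauge group, dimension and torus size; NOT a mass gap,
NOT a continuum limit, NOT a string tension; NOT Yang–Mills-summit-bearing (barriers
`FixedCouplingUltralocality`, `PerturbativeInvisibility`). Structural; it certifies no number.

## Content

Kazakov–Zheng use three families of lattice reflections — in the hyperplanes `x_i = 0` (site),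
`x_i = ½` (link) and `x_i = x_j` (diagonal) — both as SYMMETRIES identifying Wilson loops and as
sources of reflection-POSITIVITY cuts. As symmetries all three lie in the hyperoctahedral space group
`B_d ⋉ ℤ^d` handled by `BootstrapReflectionsZd` (`fullSymLevelValuesZdSuN`: translations, axis
permutations, axis = site reflections):

* `zdLinkReflectCM i = Θ_i ∘ τ_{e_i}^*` with ★ `zdLinkReflectCM_apply : … = configLinkReflect i U`
  — the link reflection is the site reflection of the unit translate;
* `zdDiagSwapCM i j = π_{(i j)}^*` with ★ `zdDiagSwapCM_apply : … = configDiagSwapZd i j U` — the diagonal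
  reflection is the axis transposition;
* ★★ `apply_comp_zdLinkReflectCM_of_invariant`, `apply_comp_zdDiagSwapCM_of_invariant` — a functional
  invariant on a word truncation under translations and site reflections (resp. axis permutations)
  is invariant under the link (resp. diagonal) reflections there; ★★
  `fullSym_invariant_threeFamilies_suN` — every functional of the fully reduced level-`n` SDP
  identifies Wilson loops related by any of the three reflection families;
* ★★ `map_configLinkReflect_eq_of_invariant`, `map_configDiagSwapZd_eq_of_invariant` — a Gibbs state
  (any finite measure) invariant under translations, axis permutations and site reflections is
  invariant under the link and diagonal reflections.

What this is NOT: reflection POSITIVITY with respect to these planes (genuine cuts, treated in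
`BootstrapRPCutDensity`, `BootstrapSiteCutsAllAxes`, `BootstrapDiagonalReflectionPositivity`; and on
`ℤ^d` in the `ClassB` files).

References: V. Kazakov, Z. Zheng, arXiv:2203.11360 §3.2–3.3 (three reflection families);
K. Osterwalder, E. Seiler, Ann. Phys. 110 (1978) 440. Folklore.
-/

noncomputable section

open MeasureTheory
open Literature.MathematicalPhysics.QuantumFieldTheory (LatticeRep)
open Literature.Probability.LatticeModels (Site)
open Literature.MathematicalPhysics.QuantumLattice

namespace Summit.QuantumFields.GaugeBoot

/-! ## The link and diagonal reflections as elements of `B_d ⋉ ℤ^d` -/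

section Maps

variable {d : ℕ} {G : Type*} [Group G] [TopologicalSpace G] [IsTopologicalGroup G] (i j : Fin d)

/-- `zdLinkReflect i x = zdSiteReflect i x + e_i`. -/
theorem zdLinkReflect_eq_zdSiteReflect_add_single (x : Site d) :
    zdLinkReflect i x = zdSiteReflect i x + Pi.single i 1 := by
  ext k
  by_cases hk : k = i
  · subst hk; simp [zdLinkReflect, zdSiteReflect]; ring
  · simp [zdLinkReflect, zdSiteReflect, hk]

/-- **The link reflection** (hyperplane `x_i = ½`) of configurations as a continuous self-map: the
site reflection composed with the unit translation along the axis. [folklore] -/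
def zdLinkReflectCM : C(LGConfig d G, LGConfig d G) :=
  (zdSiteReflectCM (G := G) i).comp (relabelCM (G := G) (edgeShift (Pi.single i 1)))

/-- ★ **It is `configLinkReflect i`** of `ClassB`. -/
@[simp] theorem zdLinkReflectCM_apply (U : LGConfig d G) :
    zdLinkReflectCM (G := G) i U = configLinkReflect i U := by
  change zdSiteReflectCM (G := G) i (relabelCM (G := G) (edgeShift (Pi.single i 1)) U) = _
  rw [zdSiteReflectCM_apply]
  funext e
  by_cases he : e.2 = i
  · simp only [configSiteReflect, configLinkReflect, he, ↓reduceIte, relabelCM_apply, edgeShift_apply,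
      zdLinkReflect_eq_zdSiteReflect_add_single, sub_add_cancel, add_sub_cancel_right]
  · simp only [configSiteReflect, configLinkReflect, he, ↓reduceIte, relabelCM_apply, edgeShift_apply,
      zdLinkReflect_eq_zdSiteReflect_add_single]

/-- An observable composed with the link reflection. -/
theorem comp_zdLinkReflectCM (x : C(LGConfig d G, ℝ)) :
    x.comp (zdLinkReflectCM (G := G) i) =
      (x.comp (zdSiteReflectCM (G := G) i)).comp (relabelCM (G := G) (edgeShift (Pi.single i 1))) := by
  rw [zdLinkReflectCM, ContinuousMap.comp_assoc]

/-- **The diagonal reflection** (hyperplane `x_i = x_j`) of configurations as a continuous self-map: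
the relabelling by the axis transposition `(i j)`. [folklore] -/
def zdDiagSwapCM : C(LGConfig d G, LGConfig d G) :=
  relabelCM (G := G) (edgePerm (Equiv.swap i j))

omit [Group G] [IsTopologicalGroup G] in
/-- ★ **It is `configDiagSwapZd i j`** of `ClassB`. -/
@[simp] theorem zdDiagSwapCM_apply (U : LGConfig d G) :
    zdDiagSwapCM (G := G) i j U = configDiagSwapZd i j U := by
  funext e
  change U (edgePerm (Equiv.swap i j) e) = U (zdDiagSwap i j e.1, Equiv.swap i j e.2)
  rw [Literature.MathematicalPhysics.QuantumLattice.edgePerm_apply]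
  rfl

omit [Group G] [IsTopologicalGroup G] in
/-- The diagonal reflection is the `relabelConfig` by the transposition (as a measurable map). -/
theorem configDiagSwapZd_eq_relabelConfig [MeasurableSpace G] (U : LGConfig d G) :
    configDiagSwapZd i j U = relabelConfig (edgePerm (Equiv.swap i j)) U := by
  rw [← zdDiagSwapCM_apply, zdDiagSwapCM, relabelCM_edgePerm_eq_relabelConfig, Equiv.swap_inv]

end Maps

/-! ## Invariance of reduced functionals under the three families -/

section Functionals

variable {d : ℕ} {G : Type*} [Group G] [TopologicalSpace G] [IsTopologicalGroup G]
  (r : LatticeRep G) (i j : Fin d)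

/-- ★★ **Translation + site-reflection invariance on a word truncation gives link-reflection
invariance there.** -/
theorem apply_comp_zdLinkReflectCM_of_invariant (n : ℕ) {φ : C(LGConfig d G, ℝ) →ₗ[ℝ] ℝ}
    (hT : ∀ (v : Site d), ∀ x ∈ wordTruncation (ι := ZdEdge d) r n,
      φ (x.comp (relabelCM (G := G) (edgeShift v))) = φ x)
    (hrefl : ∀ x ∈ wordTruncation (ι := ZdEdge d) r n, φ (x.comp (zdSiteReflectCM (G := G) i)) = φ x)
    {x : C(LGConfig d G, ℝ)} (hx : x ∈ wordTruncation (ι := ZdEdge d) r n) :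
    φ (x.comp (zdLinkReflectCM (G := G) i)) = φ x := by
  rw [comp_zdLinkReflectCM, hT _ _ (comp_zdSiteReflectCM_mem_wordTruncation i r n hx), hrefl x hx]

omit [IsTopologicalGroup G] in
/-- ★★ **Axis-permutation invariance on a word truncation gives diagonal-reflection invariance
there.** -/
theorem apply_comp_zdDiagSwapCM_of_invariant (n : ℕ) {φ : C(LGConfig d G, ℝ) →ₗ[ℝ] ℝ}
    (hperm : ∀ (σ : Equiv.Perm (Fin d)), ∀ x ∈ wordTruncation (ι := ZdEdge d) r n,
      φ (x.comp (relabelCM (G := G) (edgePerm σ))) = φ x)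
    {x : C(LGConfig d G, ℝ)} (hx : x ∈ wordTruncation (ι := ZdEdge d) r n) :
    φ (x.comp (zdDiagSwapCM (G := G) i j)) = φ x :=
  hperm (Equiv.swap i j) x hx

end Functionals

/-! ## `SU(N)`: the fully reduced SDP identifies loops related by any of the three families -/

section ZdSuN

variable {d : ℕ} (N : ℕ) (β : ℝ)

/-- ★★ **Every functional of the fully reduced level-`n` SDP is invariant, on the words of length
`≤ 2n`, under the link reflections and the diagonal reflections** (besides the translations, axis
permutations and site reflections it is defined by): the reduction by `B_d ⋉ ℤ^d` identifies Wilson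
loops related by ANY of Kazakov–Zheng's three reflection families. [folklore] -/
theorem fullSym_invariant_threeFamilies_suN {n : ℕ}
    {φ : C(LGConfig d (Matrix.specialUnitaryGroup (Fin N) ℂ), ℝ) →ₗ[ℝ] ℝ}
    (hT : ∀ (v : Fin d → ℤ), ∀ x ∈ wordTruncation (ι := ZdEdge d) (fundamentalLatticeRep N) (n + n),
      φ (x.comp (relabelCM (G := Matrix.specialUnitaryGroup (Fin N) ℂ) (edgeShift v))) = φ x)
    (hperm : ∀ (σ : Equiv.Perm (Fin d)), ∀ x ∈ wordTruncation (ι := ZdEdge d) (fundamentalLatticeRep N) (n + n),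
      φ (x.comp (relabelCM (G := Matrix.specialUnitaryGroup (Fin N) ℂ) (edgePerm σ))) = φ x)
    (hrefl : ∀ (i : Fin d), ∀ x ∈ wordTruncation (ι := ZdEdge d) (fundamentalLatticeRep N) (n + n),
      φ (x.comp (zdSiteReflectCM (G := Matrix.specialUnitaryGroup (Fin N) ℂ) i)) = φ x)
    {x : C(LGConfig d (Matrix.specialUnitaryGroup (Fin N) ℂ), ℝ)}
    (hx : x ∈ wordTruncation (ι := ZdEdge d) (fundamentalLatticeRep N) (n + n)) (i j : Fin d) (s : Finset (Fin d)) :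
    φ (x.comp (zdSiteReflectCM (G := Matrix.specialUnitaryGroup (Fin N) ℂ) i)) = φ x ∧
      φ (x.comp (zdLinkReflectCM (G := Matrix.specialUnitaryGroup (Fin N) ℂ) i)) = φ x ∧
      φ (x.comp (zdDiagSwapCM (G := Matrix.specialUnitaryGroup (Fin N) ℂ) i j)) = φ x ∧
      φ (x.comp (reflectCM (G := Matrix.specialUnitaryGroup (Fin N) ℂ) s)) = φ x :=
  ⟨hrefl i x hx, apply_comp_zdLinkReflectCM_of_invariant (fundamentalLatticeRep N) i (n + n) hT (hrefl i) hx,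
    apply_comp_zdDiagSwapCM_of_invariant (fundamentalLatticeRep N) i j (n + n) hperm hx,
    apply_comp_reflectCM_of_forall_single N
      (fun i _ hx => comp_zdSiteReflectCM_mem_wordTruncation i (fundamentalLatticeRep N) _ hx) hrefl s x hx⟩

/-! ### The fully symmetric Gibbs states are invariant under the three families -/

/-- ★★ **A measure invariant under translations and the site reflection `θ_i` is invariant under the
link reflection in `x_i = ½`.** -/
theorem map_configLinkReflect_eq_of_invariant
    {μ : Measure (LGConfig d (Matrix.specialUnitaryGroup (Fin N) ℂ))}
    (hT : IsZdTranslationInvariant μ) {i : Fin d} (hrefl : μ.map (configSiteReflect i) = μ) :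
    μ.map (configLinkReflect i) = μ := by
  have h : (configLinkReflect i : LGConfig d (Matrix.specialUnitaryGroup (Fin N) ℂ) → _) =
      configSiteReflect i ∘ relabelCM (G := Matrix.specialUnitaryGroup (Fin N) ℂ) (edgeShift (Pi.single i 1)) := by
    funext U
    rw [← zdLinkReflectCM_apply, Function.comp_apply, ← zdSiteReflectCM_apply]
    rfl
  have hshift : (relabelCM (G := Matrix.specialUnitaryGroup (Fin N) ℂ) (edgeShift (Pi.single i 1)) :
      LGConfig d (Matrix.specialUnitaryGroup (Fin N) ℂ) → _) = configShift (-(Pi.single i 1 : Fin d → ℤ)) :=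
    funext fun U => relabelCM_edgeShift_eq_configShift _ U
  rw [h, hshift, ← Measure.map_map (measurable_configSiteReflect i) (configShift _).measurable, hT, hrefl]

/-- ★★ **A measure invariant under the axis permutations is invariant under the diagonal reflection
in `x_i = x_j`.** -/
theorem map_configDiagSwapZd_eq_of_invariant
    {μ : Measure (LGConfig d (Matrix.specialUnitaryGroup (Fin N) ℂ))}
    (hperm : ∀ σ : Equiv.Perm (Fin d), μ.map (relabelConfig (edgePerm σ)) = μ) (i j : Fin d) :
    μ.map (configDiagSwapZd i j) = μ := by
  have h : (configDiagSwapZd i j : LGConfig d (Matrix.specialUnitaryGroup (Fin N) ℂ) → _) =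
      relabelConfig (edgePerm (Equiv.swap i j)) :=
    funext fun U => configDiagSwapZd_eq_relabelConfig i j U
  rw [h]
  exact hperm _

/-- ★★ **Summary: at every `β` there is a Gibbs state of `SU(N)` Yang–Mills on `ℤ^d` invariant under
the translations, the axis permutations and ALL THREE of Kazakov–Zheng's reflection families**, and
every such state's expectations are values of the fully reduced SDP at every level. [folklore] -/
theorem exists_dlr_threeFamiliesInvariant_suN :
    ∃ μ ∈ ymGibbsMeasures (d := d) (fundamentalRep (Fin N)) β,
      IsZdTranslationInvariant μ ∧ (∀ σ : Equiv.Perm (Fin d), μ.map (relabelConfig (edgePerm σ)) = μ) ∧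
        (∀ i : Fin d, μ.map (configSiteReflect i) = μ) ∧ (∀ i : Fin d, μ.map (configLinkReflect i) = μ) ∧
        (∀ i j : Fin d, μ.map (configDiagSwapZd i j) = μ) ∧
        ∀ (n : ℕ) (P : C(LGConfig d (Matrix.specialUnitaryGroup (Fin N) ℂ), ℝ)),
          ∫ U, P U ∂μ ∈ fullSymLevelValuesZdSuN (d := d) N β n P := by
  obtain ⟨μ, hμ, hT, hperm, hrefl⟩ := exists_dlr_fullSpaceGroupInvariant_suN (d := d) N β
  exact ⟨μ, hμ, hT, hperm, hrefl, fun i => map_configLinkReflect_eq_of_invariant N hT (hrefl i),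
    map_configDiagSwapZd_eq_of_invariant N hperm,
    fun n P => dlr_integral_mem_fullSymLevelValuesZd N β n hμ hT hperm hrefl P⟩

end ZdSuN

end Summit.QuantumFields.GaugeBoot

end
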